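import Literature.Computability.QuantumComplexity.PostBQPToPostIQP
import Literature.Computability.QuantumComplexity.PostBQPAmplification
import Literature.Computability.QuantumComplexity.HadamardGadgetUniform
import HarnessLib

/-!
# Post-BQP does not depend on the error tolerance (discharge of `PostBQP_subset_PostBQPWith`)

Topic `Literature/Computability/QuantumComplexity`; family `quantum-advantage`. This file proves
the named fact `Literature.Computability.QuantumComplexity.PostBQP_subset_PostBQPWith` of
`PostBQPToPostIQP.lean` (`PostBQP_subset_PostBQPWith_holds`): for every tolerance `0 < ε < 1/2`,
`PostBQP ⊆ PostBQPWith ε` — the tree's post-BQP (thresholds `2/3, 1/3`; Clifford+T, output wire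
`0`, post-selection wire `1`) is contained in post-BQP at tolerance `ε`. This is the remark of
Bremner–Jozsa–Shepherd (Proc. R. Soc. A 467 (2011), arXiv:1005.1407, §2.4 p. 6, after Def. 3):
"the standard method for reducing `ε` is to consider the majority vote answer of multiple runs of
the circuit. Similarly post-BPP and post-BQP are easily seen to be independent of the error
tolerance value too" (Aaronson 2005, §2); together with the step `PP = PostBQP` and the Hadamard
gadget it is one of the three printed steps of BJS Thm. 1 in the tree's DAG
(`PP_subset_PostIQPWith_of`).

## The argument, as formalised

The circuit-level work is the amplified family of `PostBQPAmplification.lean`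
(`PostBQPAmp.exists_amplified`): for `K = k + 1` copies of the given family `F` run in parallel
on pairwise disjoint blocks (input fanned out, copies printed verbatim between two compiled swap
layers, hence uniform), post-selected on "all copies post-select and are unanimous" with the common
verdict as output, the post-selection weight on `x` is `a^K + r^K` and the joint acceptance weight
`a^K`, where `a = Pr[out = 1 ∧ post = 1]` and `a + r = Pr[post = 1] > 0` for `F` on `x`. The
thresholds of `PostBQP` read `a ≥ 2r` on `x ∈ L` and `r ≥ 2a` on `x ∉ L`, whence the new
conditional acceptance probability `a^K/(a^K + r^K)` is `≥ 1 - ε` resp. `≤ ε` as soon as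
`ε 2^K ≥ 1` (`one_sub_le_cond`, `cond_le`; `K` from `pow_unbounded_of_one_lt`), and it stays
well defined (`pow_add_pow_pos`). Positivity of the given post-selection probability forces the
given circuits to have the two designated wires (`postselectProbOn_eq_zero_of_lt`), the side
condition of `exists_amplified`. This unanimity variant replaces the majority vote of the source
(no Chernoff bound is needed); the statement proved is the vendored one, unchanged.

## References

* M. J. Bremner, R. Jozsa, D. J. Shepherd, *Classical simulation of commuting quantum
  computations implies collapse of the polynomial hierarchy*, Proc. R. Soc. A 467 (2011)
  459–472, arXiv:1005.1407: Def. 3 (post-BQP with tolerance `ε`), §2.4 p. 6 (tolerance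
  independence; single-line post-selection registers) [BremnerJozsaShepherdPRSA2011].
* S. Aaronson, *Quantum computing, postselection, and probabilistic polynomial-time*,
  Proc. R. Soc. A 461 (2005) 3473–3482, Def. 1, §2 [Aaronson2005].
* Mathlib: `pow_unbounded_of_one_lt`, `pow_le_pow_left₀`, `le_div_iff₀`, `div_le_iff₀`.
-/

namespace Literature.Computability.QuantumComplexity

open Cryptography

/-! ### Elementary estimates for the unanimity thresholds -/

namespace PostBQPAmp

/-- `a^k + r^k > 0` when `a, r ≥ 0` and `a + r > 0`. [folklore] -/
theorem pow_add_pow_pos {a r : ℝ} (k : ℕ) (ha : 0 ≤ a) (hr : 0 ≤ r) (hs : 0 < a + r) : 0 < a ^ k + r ^ k := by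
  by_cases ha' : 0 < a
  · exact add_pos_of_pos_of_nonneg (pow_pos ha' k) (pow_nonneg hr k)
  · have ha0 : a = 0 := le_antisymm (not_lt.1 ha') ha
    have hr' : 0 < r := by rw [ha0, zero_add] at hs; exact hs
    exact add_pos_of_nonneg_of_pos (pow_nonneg ha k) (pow_pos hr' k)

/-- **Yes side**: if `a ≥ 2r` then `a^k/(a^k + r^k) ≥ 1 - ε` as soon as `ε 2^k ≥ 1`. [folklore] -/
theorem one_sub_le_cond {a r ε : ℝ} {k : ℕ} (hr : 0 ≤ r) (har : 2 * r ≤ a) (hs : 0 < a + r) (hε : 0 ≤ ε)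
    (hk : 1 ≤ ε * 2 ^ k) : 1 - ε ≤ a ^ k / (a ^ k + r ^ k) := by
  have ha : 0 < a := by
    by_contra h
    have : a ≤ 0 := not_lt.1 h
    linarith
  have hak : 0 < a ^ k := pow_pos ha k
  have hrk : 0 ≤ r ^ k := pow_nonneg hr k
  have h2 : (2 : ℝ) ^ k * r ^ k ≤ a ^ k := by
    rw [← mul_pow]; exact pow_le_pow_left₀ (by linarith) har k
  have h3 : r ^ k ≤ ε * (a ^ k + r ^ k) :=
    calc r ^ k ≤ ε * 2 ^ k * r ^ k := le_mul_of_one_le_left hrk hk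
      _ = ε * (2 ^ k * r ^ k) := by ring
      _ ≤ ε * a ^ k := mul_le_mul_of_nonneg_left h2 hε
      _ ≤ ε * (a ^ k + r ^ k) := mul_le_mul_of_nonneg_left (by linarith) hε
  rw [le_div_iff₀ (by linarith)]
  nlinarith

/-- **No side**: if `r ≥ 2a` then `a^k/(a^k + r^k) ≤ ε` as soon as `ε 2^k ≥ 1`. [folklore] -/
theorem cond_le {a r ε : ℝ} {k : ℕ} (ha : 0 ≤ a) (har : 2 * a ≤ r) (hs : 0 < a + r) (hε : 0 ≤ ε)
    (hk : 1 ≤ ε * 2 ^ k) : a ^ k / (a ^ k + r ^ k) ≤ ε := by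
  have hr : 0 < r := by linarith
  have hrk : 0 < r ^ k := pow_pos hr k
  have hak : 0 ≤ a ^ k := pow_nonneg ha k
  have h2 : (2 : ℝ) ^ k * a ^ k ≤ r ^ k := by
    rw [← mul_pow]; exact pow_le_pow_left₀ (by linarith) har k
  rw [div_le_iff₀ (by linarith)]
  calc a ^ k ≤ ε * 2 ^ k * a ^ k := le_mul_of_one_le_left hak hk
    _ = ε * (2 ^ k * a ^ k) := by ring
    _ ≤ ε * r ^ k := mul_le_mul_of_nonneg_left h2 hε
    _ ≤ ε * (a ^ k + r ^ k) := mul_le_mul_of_nonneg_left (by linarith) hε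

end PostBQPAmp

/-- **Discharge of `PostBQP_subset_PostBQPWith`: post-BQP does not depend on the error
tolerance** — `PostBQP ⊆ PostBQPWith ε` for every `0 < ε < 1/2`. Bremner–Jozsa–Shepherd, §2.4
(p. 6, after Def. 3): "the standard method for reducing `ε` is to consider the majority vote
answer of multiple runs of the circuit. Similarly post-BPP and post-BQP are easily seen to be
independent of the error tolerance value too", and "it suffices (as in [Aaronson 2005]) to use
post-selection registers of only a single line, since for any register of `k` lines we may adjoin
a circuit that computes some simple function". The proof formalised here runs `k + 1` parallel
copies (`PostBQPAmp.exists_amplified`: fan-out, copies on disjoint blocks, uniformly printed) and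
replaces the majority vote by the *unanimity* variant of the same repetition argument: the single
post-selection line is the reversibly computed `OR` of "all copies post-select and accept" and
"all copies post-select and reject", the output line the former; the conditional acceptance
probability becomes `a^{k+1}/(a^{k+1} + r^{k+1})` for the weights `a = Pr[out ∧ post]`,
`r = Pr[¬out ∧ post]` of one copy, which the thresholds `2/3, 1/3` (`a ≥ 2r` resp. `r ≥ 2a`)
push above `1 - ε` resp. below `ε` once `2^{k+1} ε ≥ 1` (`PostBQPAmp.one_sub_le_cond`,
`PostBQPAmp.cond_le`); positivity of the post-selection probability is preserved
(`PostBQPAmp.pow_add_pow_pos`), and it forces the given circuits to have the two designated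
wires (`PostBQPAmp.postselectProbOn_eq_zero_of_lt`). [cite: BremnerJozsaShepherdPRSA2011, §2.4 p. 6 (after Def. 3)] -/
theorem PostBQP_subset_PostBQPWith_holds : PostBQP_subset_PostBQPWith := by
  intro ε hε0 _ L hL
  obtain ⟨F, hfree, hU, hF⟩ := hL
  obtain ⟨k, hk⟩ := pow_unbounded_of_one_lt (1 / ε) (by norm_num : (1 : ℝ) < 2)
  have hk' : 1 ≤ ε * 2 ^ (k + 1) := by
    have h1 : 1 / ε < 2 ^ (k + 1) := hk.trans_le (pow_le_pow_right₀ (by norm_num) (Nat.le_succ k))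
    rw [div_lt_iff₀ hε0] at h1
    linarith
  obtain ⟨F', hfree', hU', hF'⟩ := PostBQPAmp.exists_amplified hfree hU (Nat.succ_pos k)
  refine ⟨F', hfree', hU', fun x => ?_⟩
  obtain ⟨hpos, hyes, hno⟩ := hF x
  have h2 : 2 ≤ x.length + F.ancillas x.length := by
    by_contra h
    exact absurd (PostBQPAmp.postselectProbOn_eq_zero_of_lt F 0 x (Nat.lt_of_not_le h)) (ne_of_gt hpos)
  obtain ⟨r, hr, hsum, hpost, hjoint⟩ := hF' x h2
  have ha : 0 ≤ F.jointAcceptProbOn 0 x := Cryptography.QCircuit.jointAcceptProb_nonneg _ _ _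
  have hs : 0 < F.jointAcceptProbOn 0 x + r := by rw [hsum]; exact hpos
  have hcond : F.condAcceptProbOn 0 x = F.jointAcceptProbOn 0 x / (F.jointAcceptProbOn 0 x + r) := by rw [hsum]; rfl
  have hcond' : F'.condAcceptProbOn 0 x =
      F.jointAcceptProbOn 0 x ^ (k + 1) / (F.jointAcceptProbOn 0 x ^ (k + 1) + r ^ (k + 1)) := by
    rw [← hpost, ← hjoint]; rfl
  refine ⟨?_, fun hx => ?_, fun hx => ?_⟩
  · rw [hpost]; exact PostBQPAmp.pow_add_pow_pos _ ha hr hs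
  · have h := hyes hx
    rw [hcond, le_div_iff₀ hs] at h
    rw [hcond']
    exact PostBQPAmp.one_sub_le_cond hr (by linarith) hs hε0.le hk'
  · have h := hno hx
    rw [hcond, div_le_iff₀ hs] at h
    rw [hcond']
    exact PostBQPAmp.cond_le ha (by linarith) hs hε0.le hk'

/-! ### `PostBQPWith ε ⊆ PostIQPWith ε` (discharge of `PostBQPWith_subset_PostIQPWith`)

The second named fact of `PostBQPToPostIQP.lean`, Bremner–Jozsa–Shepherd's Hadamard gadget
(Proc. R. Soc. A 467 (2011), Thm. 1 with its proof and Fig. 1, arXiv:1005.1407 p. 7): every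
post-selected Clifford+`T` family is compiled into a post-selected IQP family with the same
conditional acceptance probabilities. The semantic half is
`HGadget.Hop.PostBQPWith_subset_PostIQPWith_of_uniform` (`HadamardGadgetHopFamily.lean`, from the
simulation theorem of `HadamardGadgetHopSimulation.lean` for the hop compiler of
`HadamardGadgetCompiler.lean`); the uniformity half is `HGadget.Hop.gadgetFamily_isUniform`
(`HadamardGadgetUniform.lean`: the lexer `HadamardGadgetLexer.lean`, the stack machine
`HadamardGadgetAsm/Prog/Loop/Phases/Machine.lean`, and the identification of its output with the
description of the compiled family). -/

/-- **`PostBQPWith ε ⊆ PostIQPWith ε` for every threshold `ε`** (Bremner–Jozsa–Shepherd 2011,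
Thm. 1, the inclusion `PostBQP ⊆ PostIQP` of its proof, error threshold by threshold): the
discharge of the named fact `PostBQPWith_subset_PostIQPWith`.
[cite: BremnerJozsaShepherdPRSA2011, Thm. 1 (proof, Fig. 1: the Hadamard gadget)] -/
theorem PostBQPWith_subset_PostIQPWith_holds : PostBQPWith_subset_PostIQPWith :=
  HGadget.Hop.PostBQPWith_subset_PostIQPWith_of_uniform fun F hF hU => HGadget.Hop.gadgetFamily_isUniform F hF hU

end Literature.Computability.QuantumComplexity
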